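import Mathlib
import HarnessLib
import Summits.HubbardSuperconductivity.HubbardSuperconductivity.Theorems.KLProgrammeKLRegimeCountertermOneVolumeJD
import Summits.HubbardSuperconductivity.HubbardSuperconductivity.Theorems.KLProgrammeKLRegimeCountertermShape
import Summits.HubbardSuperconductivity.HubbardSuperconductivity.Theorems.KLProgrammeKLRegimeSplitBundleV14

/-!
# Route `KLProgramme` — child Counterterm of crux K3 FOR EVERY BUNDLE WHOSE FRAME SLOT ADMITS A SELF-MAP PROVIDER AND WHOSE TWO-LEG SLOT
# IMPLIES THE THIN BLOCK WITH (E3c) KEYED ON THE FRAME SLOT (`CountertermP2 Pr klWindowC`; seat hubbard-kl-k3c3-p2, «fixed point on FrameOK's tube»)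

**`CtJ.countertermP2_of_shapeJD`** — the bundle-generic body of child 2 on the chain `…CountertermContinuationJD` / `ct_oneVolume_thresholdsJD`
(`…CountertermOneVolumeJD`), written for plan g14's (R12) RULING (HOME STATUS 2026-08-27T05:56:26Z: gen-6 `klPredsV15` with T1a `frameOK := FrameOKDeg`,
(E3c) `FrameLipschitzFnTD` capping the comparison frame `K′`, T1b `TwoLegSizesMSTQ` with `msBarQ = Q.CE·twoLegBar … 1 n`, T1c `TwoLegStepV15`).
Let `Pr : Preds` be any bundle with
* frame slot INSIDE `FrameOK` at child 2's package: `Pr.frameOK (ctRenMs G) U N μ K → FrameOK (ctRenMs G) U N μ K`;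
* `RenormalisedAtF → Pr.renorm`; a comparison-frame HISTORY `H` implied by `Pr.split ∧ RenormalisedAtF ∧ Pr.engine`;
* a two-leg slot IMPLYING, at `R = ctRenMs G`, the thin block: symmetric `C⁴` piece with tier-1 (`j ≤ 2`) sizes; the frame-Lipschitz bound against every
  comparison frame `K′` IN THE FRAME SLOT carrying `H` below the scale (so `FrameLipschitzFnT` — K′ over `FrameOK` ⊇ slot — and `FrameLipschitzFnTD` —
  K′ over `FrameOKDeg` = slot — both qualify); an ABSTRACT per-scale conjunct `X`;
* the (E3f) rate at `(L, M, n)` towards every comparison volume `(L′, M′) ≥ (L, max M0 Mq)`, keyed on `HistP Pr` at EVERY volume `(L″, M″) ≥ (L, max M0 Mq)`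
  for a READER-SUPPLIED cutoff threshold `Mq` (covers V14's single-volume antecedent and the threshold-parametric / eventual forms of gen 6's
  (E3f-A); child 2 takes `Mq := max Mh M0` and transfers SCALE-MAJOR, `ct_volumeTransfer_of_rateA`);
* a self-map PROVIDER for (frame slot at `ctRenMs G`, `X`) — landed instances: `selfMapProviderA_msBar` (gen 5), `selfMapProviderA_degCap_numeral`
  (degree cap, today's MS), `selfMapProviderA_degCapNumeral_of_ceBudget` (degree cap, `Q.CE`-keyed MS = gen 6).
Then `CountertermP2 Pr klWindowC`.  Corollaries: `countertermP2_of_shapeJD_frameOK` (slot = `FrameOK`, today's MS; gen 5 `klPredsV14` re-derived as an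
`example`) and **`countertermP2_of_shapeJD_degCapQ`** (slot `↔ FrameOK ∧ K.degree ≤ 2^21·16^N`, `X` unfolding to the `Q.CE`-keyed (E3a-MS)
decomposition) — the gen-6 body `CountertermP2 klPredsV15 klWindowC` is ONE instance of the latter (`Iff.rfl`, identity maps, the V15 accessors).
Proofs only; nothing is asserted about the Hubbard model beyond the hypothesis blocks; nothing here asserts superconductivity.
-/

noncomputable section

namespace Summit.HubbardSuperconductivity.HubbardSuperconductivity.Theorems.KLRegimeSplit

set_option linter.dupNamespace false -- summit = problem name (single-conjunct summit), D-0017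

open Real Finset
open Literature.MathematicalPhysics.QuantumLattice Literature.Probability.LatticeModels
open Summit.HubbardSuperconductivity.HubbardSuperconductivity.Theorems.KLProgrammeLegKernels

/-! ## §0 The SCALE-MAJOR volume transfer (for (E3f) clauses whose antecedent is the history at every volume from the construction volume up) -/

/-- **VOLUME TRANSFER from a rate, SCALE-MAJOR** (twin of `ct_volumeTransfer_of_rate`, …CountertermShape): if at the construction volume `(L₀, M₀)`
the frame `K` is within HALF tolerance at every scale with `CL n / L₀` in the other half, and at every scale `n` the renormalisation of `K` BELOW `n`
at EVERY target volume `(L, M) ≥ (L₀, Mc)` yields the rate `|ν_n^{L₀,M₀}(θ) − ν_n^{L,M}(θ)| ≤ CL n / L₀` at every such volume, then `K` is renormalised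
(package `R`, `cr = ctCr G`) at every scale at every such volume — strong induction on the scale, all volumes at once (the order k3c4-p1 g6's (E3f-A)
antecedent «history at every volume from `L` up» asks for; HOME STATUS 2026-08-27T06:02:48Z (3c)). -/
theorem ct_volumeTransfer_of_rateA {G : GeoConsts} {R : RenConsts} (hcr : R.cr = ctCr G) {β U μ : ℝ} {CL : ℕ → ℝ}
    {K : TrigPolyC4v} {L₀ M₀ : ℕ} [NeZero L₀] [NeZero M₀] {Mc : ℕ → ℕ}
    (rate : ∀ n : ℕ, n ≤ nScales β →
      (∀ (L M : ℕ) [NeZero L] [NeZero M], L₀ ≤ L → Mc L ≤ M → ∀ j < n, RenormalisedAtF L M β U μ K R j) →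
        ∀ (L M : ℕ) [NeZero L] [NeZero M], L₀ ≤ L → Mc L ≤ M →
          ∀ θ : ℝ, |klLocalPart L₀ M₀ β U μ K n θ - klLocalPart L M β U μ K n θ| ≤ CL n / L₀)
    (hhalf : ∀ n : ℕ, n ≤ nScales β →
      (∀ θ : ℝ, |klLocalPart L₀ M₀ β U μ K n θ| ≤ ctCr G * |U| * klScale klE0 n ^ 2 / klE0 / 2) ∧
      CL n / L₀ ≤ ctCr G * |U| * klScale klE0 n ^ 2 / klE0 / 2) :
    ∀ n : ℕ, n ≤ nScales β → ∀ (L M : ℕ) [NeZero L] [NeZero M], L₀ ≤ L → Mc L ≤ M →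
      RenormalisedAtF L M β U μ K R n := by
  intro n
  induction n using Nat.strong_induction_on with
  | _ n ih =>
    intro hn L M _ _ hL hM θ
    have hall : ∀ (L M : ℕ) [NeZero L] [NeZero M], L₀ ≤ L → Mc L ≤ M → ∀ j < n, RenormalisedAtF L M β U μ K R j :=
      fun L M _ _ hL hM j hj => ih j hj (le_of_lt (lt_of_lt_of_le hj hn)) L M hL hM
    have hrate := rate n hn hall L M hL hM θ
    have hhalfθ := (hhalf n hn).1 θ
    have hCL := (hhalf n hn).2
    show |klLocalPart L M β U μ K n θ| ≤ R.cr * |U| * klScale klE0 n ^ 2 / klE0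
    rw [hcr]
    have htri : |klLocalPart L M β U μ K n θ| ≤
        |klLocalPart L₀ M₀ β U μ K n θ| + |klLocalPart L₀ M₀ β U μ K n θ - klLocalPart L M β U μ K n θ| := by
      have h1 := abs_sub_abs_le_abs_sub (klLocalPart L M β U μ K n θ) (klLocalPart L₀ M₀ β U μ K n θ)
      rw [abs_sub_comm] at h1
      linarith
    linarith

namespace CtJ

/-! ## §1 The generic child -/

section Shape

variable {Pr : Preds}

/-- The symmetric-frame conjunct of the thin block from an (E3a-MS)-type slot decomposition: if the scale-`n` function piece is a finite sum of
symmetric slots, it is a symmetric frame. -/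
theorem isSymmetricFrame_pieceFn_of_sizesMSFn {L M : ℕ} [NeZero L] [NeZero M] {G : GeoConsts} {Q : EngConsts} {R : RenConsts}
    {β U μ : ℝ} {K : TrigPolyC4v} {n : ℕ} (h : TwoLegSizesMSFn L M G Q R β U μ K.eval n) :
    IsSymmetricFrame (klTwoLegPieceFn L M β U μ K.eval n) := by
  obtain ⟨lp, hdec, hreg, -, -⟩ := h
  have hfun : klTwoLegPieceFn L M β U μ K.eval n = fun p => lp n p + ∑ m ∈ Ioc n (nScales β), lp m p := funext hdec
  rw [hfun]
  exact (hreg n).1.add' (isSymmetricFrame_finset_sum _ fun m _ => (hreg m).1)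

/-- **CHILD COUNTERTERM FOR EVERY BUNDLE WHOSE FRAME SLOT ADMITS A SELF-MAP PROVIDER AND WHOSE TWO-LEG SLOT IMPLIES THE THIN BLOCK.**
See the module docstring.  `H` = the comparison-frame history the bundle's (E3c) clause is keyed on; `X` = the per-scale conjunct the provider's
step consumes; `hV` = the (E3f) rate at any larger comparison volume carrying `HistP Pr`; `hsmP` = the provider at child 2's package `ctRenMs G`.
Conclusion: `CountertermP2 Pr klWindowC` — one frame IN THE BUNDLE'S FRAME SLOT, chosen before the volume, renormalised at every scale at every
volume past child 2's thresholds. -/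
theorem countertermP2_of_shapeJD
    (H : (L M : ℕ) → [NeZero L] → [NeZero M] → GeoConsts → SplitConsts → EngConsts → RenConsts → ℝ → ℝ → ℝ →
      TrigPolyC4v → ℕ → Prop)
    (X : (L M : ℕ) → [NeZero L] → [NeZero M] → GeoConsts → EngConsts → RenConsts → ℝ → ℝ → ℝ → TrigPolyC4v → ℕ → Prop)
    (hAF : ∀ (G : GeoConsts) (U : ℝ) (N : ℕ) (μ : ℝ) (K : TrigPolyC4v),
      Pr.frameOK (ctRenMs G) U N μ K → FrameOK (ctRenMs G) U N μ K)
    (hR : ∀ (L M : ℕ) [NeZero L] [NeZero M] (β U μ : ℝ) (K : TrigPolyC4v) (R : RenConsts) (n : ℕ),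
      RenormalisedAtF L M β U μ K R n → Pr.renorm L M β U μ K R n)
    (hH : ∀ (L M : ℕ) [NeZero L] [NeZero M] (G : GeoConsts) (P : SplitConsts) (Q : EngConsts) (R : RenConsts) (β U μ : ℝ)
      (K : TrigPolyC4v) (n : ℕ), Pr.split L M G P Q β U μ K n → RenormalisedAtF L M β U μ K R n →
        Pr.engine L M G P Q β U μ K n → H L M G P Q R β U μ K n)
    (hT : ∀ (L M : ℕ) [NeZero L] [NeZero M] (G : GeoConsts) (P : SplitConsts) (Q : EngConsts) (β U μ : ℝ)
      (K : TrigPolyC4v) (n : ℕ), Pr.twoLeg L M G P Q (ctRenMs G) β U μ K n →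
        (IsSymmetricFrame (klTwoLegPieceFn L M β U μ K.eval n) ∧ ContDiff ℝ 4 (onM (klTwoLegPieceFn L M β U μ K.eval n)) ∧
          ∀ j ≤ 2, ∀ q : Momentum, ‖iteratedFDeriv ℝ j (onM (klTwoLegPieceFn L M β U μ K.eval n)) q‖ ≤ twoLegBar G Q U j n) ∧
        (∀ K' : TrigPolyC4v, Pr.frameOK (ctRenMs G) U (nScales β) μ K' → (∀ j < n, H L M G P Q (ctRenMs G) β U μ K' j) →
          ∀ q : Fin 2 → ℝ, |klTwoLegPieceFn L M β U μ K.eval n q - klTwoLegPieceFn L M β U μ K'.eval n q| ≤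
            lipBar G Q U n * frameDist K K') ∧
          X L M G Q (ctRenMs G) β U μ K n)
    (hV : ∀ (L M : ℕ) [NeZero L] [NeZero M] (G : GeoConsts) (P : SplitConsts) (Q : EngConsts) (R : RenConsts) (β U μ : ℝ)
      (K : TrigPolyC4v) (n : ℕ) (Mq : ℕ → ℕ), Pr.twoLeg L M G P Q R β U μ K n → Q.M0 β L ≤ M → Mq L ≤ M →
        (∀ (L'' M'' : ℕ) [NeZero L''] [NeZero M''], L ≤ L'' → Q.M0 β L'' ≤ M'' → Mq L'' ≤ M'' →
          HistP Pr L'' M'' G P Q R β U μ K n) →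
        ∀ (L' M' : ℕ) [NeZero L'] [NeZero M'], L ≤ L' → Q.M0 β L' ≤ M' → Mq L' ≤ M' →
          ∀ θ : ℝ, |klLocalPart L M β U μ K n θ - klLocalPart L' M' β U μ K n θ| ≤ Q.CL β n / L)
    (hsmP : ∀ (G : GeoConsts) (Q : EngConsts), G.WF → Q.WF →
      ∃ c₄ : ℝ, 0 < c₄ ∧ ∃ U₄ : ℝ, 0 < U₄ ∧ ∀ c U β : ℝ, 0 < c → c ≤ c₄ → 0 < U → U ≤ U₄ →
        klBetaMin ≤ β → β ≤ Real.exp (c / U ^ 2) → ∀ μ ∈ klWindowC,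
          Pr.frameOK (ctRenMs G) U (nScales β) μ 0 ∧ ∃ d : ℕ,
            (1 + 4 / 3 * (G.SL + Q.SL * |U|) * |U|) * (1 + 2 * (4 / 3 * (G.SL + Q.SL * |U|) * |U|)) *
                (π ^ 6 / (d + 1) * ∑ i ∈ range (nScales β + 1), twoLegBar G Q U 1 i) ≤
              |U| * ((16 : ℝ) ^ nScales β)⁻¹ / 256 ∧
            ∀ (L M : ℕ) [NeZero L] [NeZero M],
              ∀ K : TrigPolyC4v, Pr.frameOK (ctRenMs G) U (nScales β) μ K → ∀ n : ℕ, n ≤ nScales β →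
                (∀ i ≤ n, X L M G Q (ctRenMs G) β U μ K i) →
                  Pr.frameOK (ctRenMs G) U (nScales β) μ (ctIterJ L M d β U μ K n)) :
    CountertermP2 Pr klWindowC := by
  intro G P hG _
  refine ⟨ctRenMs G, ctRenMs_WF2 hG, fun Q hQ => ?_⟩
  obtain ⟨c₁, hc₁, hc⟩ := ct_oneVolume_thresholdsJD G Q hG hQ (fun β U μ K => Pr.frameOK (ctRenMs G) U (nScales β) μ K)
    (fun β U μ K h => hAF G U (nScales β) μ K h) (fun L M _ _ β U μ K i => X L M G Q (ctRenMs G) β U μ K i) (hsmP G Q hG hQ)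
  refine ⟨c₁, hc₁, fun c hc0 hcc => ?_⟩
  obtain ⟨U₀, hU₀, hmain⟩ := hc c hc0 hcc
  refine ⟨U₀, hU₀, fun μ hμ U hU hUle β hβ hβc Lh Mh hhyp => ?_⟩
  have hCL : ∀ n, 0 ≤ Q.CL β n := fun n => hQ.2.2.2.2.2.2.2 β n
  obtain ⟨L₀, M₀, hL₀pos, hM₀pos, hLh, hMh, hM0, hrate, hvol⟩ :=
    hmain μ hμ U hU hUle β hβ hβc Lh Mh (Q.M0 β) (Q.CL β) hCL
  haveI : NeZero L₀ := ⟨Nat.pos_iff_ne_zero.mp hL₀pos⟩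
  haveI : NeZero M₀ := ⟨Nat.pos_iff_ne_zero.mp hM₀pos⟩
  -- the thin block at any volume beyond the thresholds, keyed on the bundle's frame slot, from the hypothesis block of `CountertermP2`
  have blkAt : ∀ (L M : ℕ) [NeZero L] [NeZero M], Lh ≤ L → Mh L ≤ M →
      ∀ K : TrigPolyC4v, Pr.frameOK (ctRenMs G) U (nScales β) μ K → ∀ n : ℕ, n ≤ nScales β →
        (∀ j < n, RenormalisedAtF L M β U μ K (ctRenMs G) j) →
          (IsSymmetricFrame (klTwoLegPieceFn L M β U μ K.eval n) ∧ ContDiff ℝ 4 (onM (klTwoLegPieceFn L M β U μ K.eval n)) ∧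
            ∀ j ≤ 2, ∀ q : Momentum, ‖iteratedFDeriv ℝ j (onM (klTwoLegPieceFn L M β U μ K.eval n)) q‖ ≤ twoLegBar G Q U j n) ∧
            (∀ K' : TrigPolyC4v, Pr.frameOK (ctRenMs G) U (nScales β) μ K' → (∀ j < n, H L M G P Q (ctRenMs G) β U μ K' j) →
              ∀ q : Fin 2 → ℝ, |klTwoLegPieceFn L M β U μ K.eval n q - klTwoLegPieceFn L M β U μ K'.eval n q| ≤
                lipBar G Q U n * frameDist K K') ∧
              X L M G Q (ctRenMs G) β U μ K n ∧
                (RenormalisedAtF L M β U μ K (ctRenMs G) n → H L M G P Q (ctRenMs G) β U μ K n) := by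
    intro L M _ _ hL hM K hK n hn hren
    obtain ⟨hE, hTw, hS⟩ := hhyp K hK L M hL hM n hn fun j hj => hR _ _ _ _ _ _ _ _ (hren j hj)
    have ht := hT _ _ _ _ _ _ _ _ _ _ hTw
    exact ⟨ht.1, ht.2.1, ht.2.2, fun hr => hH _ _ _ _ _ _ _ _ _ _ _ hS hr hE⟩
  -- the one-volume construction at `(L₀, M₀)`: a frame IN THE SLOT, within half tolerance at every scale and real angle
  obtain ⟨K, hK, hhalf⟩ := hvol inferInstance inferInstance (H L₀ M₀ G P Q (ctRenMs G) β U μ) (blkAt L₀ M₀ hLh hMh)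
  refine ⟨K, hK, L₀, fun L => max (Mh L) (Q.M0 β L), fun L M _ _ hL hM n hn => hR _ _ _ _ _ _ _ _ ?_⟩
  -- renormalisation at the construction volume, at every scale (half tolerance ≤ tolerance)
  have htol_nonneg : ∀ n, 0 ≤ ctCr G * |U| * klScale klE0 n ^ 2 / klE0 / 2 := by
    intro n
    have hS : ∀ j, 0 ≤ G.S j := hG.2.2.2.2.2.2.2.2.2.2.2.2.2.2.2.2.2.1
    have hcr : 0 ≤ ctCr G := by unfold ctCr; nlinarith [hS 0]
    have he0 : (0 : ℝ) < klE0 := by norm_num [klE0]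
    positivity
  have hren0 : ∀ n, n ≤ nScales β → RenormalisedAtF L₀ M₀ β U μ K (ctRenMs G) n := by
    intro n hn θ
    have h := hhalf n hn θ
    show |klLocalPart L₀ M₀ β U μ K n θ| ≤ ctCr G * |U| * klScale klE0 n ^ 2 / klE0
    linarith [htol_nonneg n]
  -- the rate between the construction volume and EVERY larger volume at scale `n`, from (E3f) at `(L₀, M₀)` and `HistP Pr` at every volume
  -- `(L″, M″) ≥ (L₀, max Mh M0)` — the latter from the block and the renormalisation BELOW `n` at all those volumes (scale-major order)
  have rate : ∀ n : ℕ, n ≤ nScales β →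
      (∀ (L M : ℕ) [NeZero L] [NeZero M], L₀ ≤ L → max (Mh L) (Q.M0 β L) ≤ M →
        ∀ j < n, RenormalisedAtF L M β U μ K (ctRenMs G) j) →
      ∀ (L M : ℕ) [NeZero L] [NeZero M], L₀ ≤ L → max (Mh L) (Q.M0 β L) ≤ M →
        ∀ θ : ℝ, |klLocalPart L₀ M₀ β U μ K n θ - klLocalPart L M β U μ K n θ| ≤ Q.CL β n / L₀ := by
    intro n hn hall L M _ _ hL hM θ
    obtain ⟨_, hTw, _⟩ := hhyp K hK L₀ M₀ hLh hMh n hn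
      fun j hj => hR _ _ _ _ _ _ _ _ (hren0 j (le_of_lt (lt_of_lt_of_le hj hn)))
    have hhistAll : ∀ (L'' M'' : ℕ) [NeZero L''] [NeZero M''], L₀ ≤ L'' → Q.M0 β L'' ≤ M'' →
        max (Mh L'') (Q.M0 β L'') ≤ M'' → HistP Pr L'' M'' G P Q (ctRenMs G) β U μ K n := by
      intro L'' M'' _ _ hL'' _ hM'' j hj
      have hMh'' : Mh L'' ≤ M'' := (le_max_left _ _).trans hM''
      obtain ⟨hE, hTwj, hS⟩ := hhyp K hK L'' M'' (hLh.trans hL'') hMh'' j (le_of_lt (lt_of_lt_of_le hj hn))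
        fun i hi => hR _ _ _ _ _ _ _ _ (hall L'' M'' hL'' hM'' i (hi.trans hj))
      exact ⟨hS, hR _ _ _ _ _ _ _ _ (hall L'' M'' hL'' hM'' j hj), hE, hTwj⟩
    exact hV _ _ _ _ _ _ _ _ _ _ _ (fun L => max (Mh L) (Q.M0 β L)) hTw hM0 (max_le hMh hM0) hhistAll L M hL
      ((le_max_right _ _).trans hM) hM θ
  exact ct_volumeTransfer_of_rateA (G := G) (R := ctRenMs G) rfl rate (fun n hn => ⟨hhalf n hn, hrate n hn⟩) n hn L M hL hM

/-- **Corollary — frame slot `FrameOK`, today's (E3a-MS) text.**  For a bundle with `Pr.frameOK = FrameOK` (as an `↔` at every argument),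
`RenormalisedAtF → Pr.renorm`, a history `H` from `split ∧ renorm ∧ engine`, a two-leg slot implying (at `ctRenMs G`) the `C⁴` + tier-1 sizes,
`FrameLipschitzFnT H` and `TwoLegSizesMSFn … K.eval`, and the `HistP`-keyed rate: `CountertermP2 Pr klWindowC` — the provider is
`selfMapProviderA_msBar`, the symmetric conjunct comes from the MS decomposition. -/
theorem countertermP2_of_shapeJD_frameOK
    (H : (L M : ℕ) → [NeZero L] → [NeZero M] → GeoConsts → SplitConsts → EngConsts → RenConsts → ℝ → ℝ → ℝ →
      TrigPolyC4v → ℕ → Prop)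
    (hPF : ∀ (R : RenConsts) (U : ℝ) (N : ℕ) (μ : ℝ) (K : TrigPolyC4v), Pr.frameOK R U N μ K ↔ FrameOK R U N μ K)
    (hR : ∀ (L M : ℕ) [NeZero L] [NeZero M] (β U μ : ℝ) (K : TrigPolyC4v) (R : RenConsts) (n : ℕ),
      RenormalisedAtF L M β U μ K R n → Pr.renorm L M β U μ K R n)
    (hH : ∀ (L M : ℕ) [NeZero L] [NeZero M] (G : GeoConsts) (P : SplitConsts) (Q : EngConsts) (R : RenConsts) (β U μ : ℝ)
      (K : TrigPolyC4v) (n : ℕ), Pr.split L M G P Q β U μ K n → RenormalisedAtF L M β U μ K R n →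
        Pr.engine L M G P Q β U μ K n → H L M G P Q R β U μ K n)
    (hT : ∀ (L M : ℕ) [NeZero L] [NeZero M] (G : GeoConsts) (P : SplitConsts) (Q : EngConsts) (β U μ : ℝ)
      (K : TrigPolyC4v) (n : ℕ), Pr.twoLeg L M G P Q (ctRenMs G) β U μ K n →
        (ContDiff ℝ 4 (onM (klTwoLegPieceFn L M β U μ K.eval n)) ∧
          ∀ j ≤ 2, ∀ q : Momentum, ‖iteratedFDeriv ℝ j (onM (klTwoLegPieceFn L M β U μ K.eval n)) q‖ ≤ twoLegBar G Q U j n) ∧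
        FrameLipschitzFnT L M (H L M G P Q (ctRenMs G) β U μ) G Q (ctRenMs G) β U μ K n ∧
          TwoLegSizesMSFn L M G Q (ctRenMs G) β U μ K.eval n)
    (hV : ∀ (L M : ℕ) [NeZero L] [NeZero M] (G : GeoConsts) (P : SplitConsts) (Q : EngConsts) (R : RenConsts) (β U μ : ℝ)
      (K : TrigPolyC4v) (n : ℕ) (Mq : ℕ → ℕ), Pr.twoLeg L M G P Q R β U μ K n → Q.M0 β L ≤ M → Mq L ≤ M →
        (∀ (L'' M'' : ℕ) [NeZero L''] [NeZero M''], L ≤ L'' → Q.M0 β L'' ≤ M'' → Mq L'' ≤ M'' →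
          HistP Pr L'' M'' G P Q R β U μ K n) →
        ∀ (L' M' : ℕ) [NeZero L'] [NeZero M'], L ≤ L' → Q.M0 β L' ≤ M' → Mq L' ≤ M' →
          ∀ θ : ℝ, |klLocalPart L M β U μ K n θ - klLocalPart L' M' β U μ K n θ| ≤ Q.CL β n / L) :
    CountertermP2 Pr klWindowC := by
  refine countertermP2_of_shapeJD H (fun L M _ _ G Q R β U μ K n => TwoLegSizesMSFn L M G Q R β U μ K.eval n)
    (fun G U N μ K h => (hPF _ U N μ K).1 h) hR hH (fun L M _ _ G P Q β U μ K n h => ?_) hV (fun G Q hG hQ => ?_)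
  · have ht := hT L M G P Q β U μ K n h
    exact ⟨⟨isSymmetricFrame_pieceFn_of_sizesMSFn ht.2.2, ht.1.1, ht.1.2⟩,
      fun K' hK' hh q => ht.2.1 K' ((hPF _ _ _ _ _).1 hK') hh q, ht.2.2⟩
  · obtain ⟨c₄, hc₄, U₄, hU₄, h⟩ := selfMapProviderA_msBar G Q hG hQ
    refine ⟨c₄, hc₄, U₄, hU₄, fun c U β hc hcc hU hUU hβ hβc μ hμ => ?_⟩
    obtain ⟨h0, d, hd, hstep⟩ := h c U β hc hcc hU hUU hβ hβc μ hμ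
    exact ⟨(hPF _ _ _ _ _).2 h0, d, hd, fun L M _ _ K hK n hn hX => (hPF _ _ _ _ _).2 (hstep L M K ((hPF _ _ _ _ _).1 hK) n hn hX)⟩

/-- **Corollary — the GEN-6 SHAPE: (R-deg) degree-capped frame slot `FrameOK ∧ K.degree ≤ 2^21·16^N`, (E3c) capping `K′`, `Q.CE`-keyed (E3a-MS).**
For a bundle whose frame slot is (`↔` at every argument) `FrameOK R U N μ K ∧ K.degree ≤ 2^21·16^N` (T1a `FrameOKDeg`, `klFrameDeg N = 2^21·16^N`),
`RenormalisedAtF → Pr.renorm`, a history `H` from `split ∧ renorm ∧ engine`, a two-leg slot implying (at `ctRenMs G`) the `C⁴` + tier-1 sizes, the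
frame-Lipschitz bound against comparison frames IN THE SLOT (T1a `FrameLipschitzFnTD`), and a conjunct `X` unfolding to the (E3a-MS) slot decomposition
with fine budgets `Q.CE·twoLegBar G Q U 1 n·(R.Gfr j·uPow j U·4^{(j−2)m})` (T1b `TwoLegSizesMSTQ`), plus the `HistP`-keyed rate: `CountertermP2 Pr klWindowC`.
Provider: `selfMapProviderA_degCapNumeral_of_ceBudget`; symmetric conjunct from the decomposition. -/
theorem countertermP2_of_shapeJD_degCapQ
    (H : (L M : ℕ) → [NeZero L] → [NeZero M] → GeoConsts → SplitConsts → EngConsts → RenConsts → ℝ → ℝ → ℝ →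
      TrigPolyC4v → ℕ → Prop)
    (X : (L M : ℕ) → [NeZero L] → [NeZero M] → GeoConsts → EngConsts → RenConsts → ℝ → ℝ → ℝ → TrigPolyC4v → ℕ → Prop)
    (hPF : ∀ (R : RenConsts) (U : ℝ) (N : ℕ) (μ : ℝ) (K : TrigPolyC4v),
      Pr.frameOK R U N μ K ↔ (FrameOK R U N μ K ∧ K.degree ≤ 2 ^ 21 * 16 ^ N))
    (hR : ∀ (L M : ℕ) [NeZero L] [NeZero M] (β U μ : ℝ) (K : TrigPolyC4v) (R : RenConsts) (n : ℕ),
      RenormalisedAtF L M β U μ K R n → Pr.renorm L M β U μ K R n)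
    (hH : ∀ (L M : ℕ) [NeZero L] [NeZero M] (G : GeoConsts) (P : SplitConsts) (Q : EngConsts) (R : RenConsts) (β U μ : ℝ)
      (K : TrigPolyC4v) (n : ℕ), Pr.split L M G P Q β U μ K n → RenormalisedAtF L M β U μ K R n →
        Pr.engine L M G P Q β U μ K n → H L M G P Q R β U μ K n)
    (hX : ∀ (L M : ℕ) [NeZero L] [NeZero M] (G : GeoConsts) (Q : EngConsts) (β U μ : ℝ) (K : TrigPolyC4v) (i : ℕ),
      X L M G Q (ctRenMs G) β U μ K i →
        ∃ lp : ℕ → FrameFn,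
          (∀ p : Fin 2 → ℝ, klTwoLegPieceFn L M β U μ K.eval i p = lp i p + ∑ m ∈ Ioc i (nScales β), lp m p) ∧
          (∀ m, IsSymmetricFrame (lp m) ∧ ContDiff ℝ 4 (onM (lp m))) ∧
          (∀ j ≤ 4, ∀ q : Momentum, ‖iteratedFDeriv ℝ j (onM (lp i)) q‖ ≤ twoLegBar G Q U j i) ∧
          (∀ m ∈ Ioc i (nScales β), ∀ j ≤ 4, ∀ q : Momentum, ‖iteratedFDeriv ℝ j (onM (lp m)) q‖ ≤
            Q.CE * twoLegBar G Q U 1 i * ((ctRenMs G).Gfr j * uPow j U * (4 : ℝ) ^ (((j : ℤ) - 2) * m))))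
    (hT : ∀ (L M : ℕ) [NeZero L] [NeZero M] (G : GeoConsts) (P : SplitConsts) (Q : EngConsts) (β U μ : ℝ)
      (K : TrigPolyC4v) (n : ℕ), Pr.twoLeg L M G P Q (ctRenMs G) β U μ K n →
        (ContDiff ℝ 4 (onM (klTwoLegPieceFn L M β U μ K.eval n)) ∧
          ∀ j ≤ 2, ∀ q : Momentum, ‖iteratedFDeriv ℝ j (onM (klTwoLegPieceFn L M β U μ K.eval n)) q‖ ≤ twoLegBar G Q U j n) ∧
        (∀ K' : TrigPolyC4v, Pr.frameOK (ctRenMs G) U (nScales β) μ K' → (∀ j < n, H L M G P Q (ctRenMs G) β U μ K' j) →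
          ∀ q : Fin 2 → ℝ, |klTwoLegPieceFn L M β U μ K.eval n q - klTwoLegPieceFn L M β U μ K'.eval n q| ≤
            lipBar G Q U n * frameDist K K') ∧
          X L M G Q (ctRenMs G) β U μ K n)
    (hV : ∀ (L M : ℕ) [NeZero L] [NeZero M] (G : GeoConsts) (P : SplitConsts) (Q : EngConsts) (R : RenConsts) (β U μ : ℝ)
      (K : TrigPolyC4v) (n : ℕ) (Mq : ℕ → ℕ), Pr.twoLeg L M G P Q R β U μ K n → Q.M0 β L ≤ M → Mq L ≤ M →
        (∀ (L'' M'' : ℕ) [NeZero L''] [NeZero M''], L ≤ L'' → Q.M0 β L'' ≤ M'' → Mq L'' ≤ M'' →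
          HistP Pr L'' M'' G P Q R β U μ K n) →
        ∀ (L' M' : ℕ) [NeZero L'] [NeZero M'], L ≤ L' → Q.M0 β L' ≤ M' → Mq L' ≤ M' →
          ∀ θ : ℝ, |klLocalPart L M β U μ K n θ - klLocalPart L' M' β U μ K n θ| ≤ Q.CL β n / L) :
    CountertermP2 Pr klWindowC := by
  refine countertermP2_of_shapeJD H X (fun G U N μ K h => ((hPF _ U N μ K).1 h).1) hR hH
    (fun L M _ _ G P Q β U μ K n h => ?_) hV (fun G Q hG hQ => ?_)
  · have ht := hT L M G P Q β U μ K n h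
    have hsym : IsSymmetricFrame (klTwoLegPieceFn L M β U μ K.eval n) := by
      obtain ⟨lp, hdec, hreg, -, -⟩ := hX L M G Q β U μ K n ht.2.2
      have hfun : klTwoLegPieceFn L M β U μ K.eval n = fun p => lp n p + ∑ m ∈ Ioc n (nScales β), lp m p := funext hdec
      rw [hfun]
      exact (hreg n).1.add' (isSymmetricFrame_finset_sum _ fun m _ => (hreg m).1)
    exact ⟨⟨hsym, ht.1.1, ht.1.2⟩, ht.2.1, ht.2.2⟩
  · obtain ⟨c₄, hc₄, U₄, hU₄, h⟩ := selfMapProviderA_degCapNumeral_of_ceBudget G Q hG hQ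
      (fun L M _ _ β U μ K i => X L M G Q (ctRenMs G) β U μ K i) (fun L M _ _ β U μ K i hx => hX L M G Q β U μ K i hx)
    refine ⟨c₄, hc₄, U₄, hU₄, fun c U β hc hcc hU hUU hβ hβc μ hμ => ?_⟩
    obtain ⟨h0, d, hd, hstep⟩ := h c U β hc hcc hU hUU hβ hβc μ hμ
    exact ⟨(hPF _ _ _ _ _).2 h0, d, hd, fun L M _ _ K hK n hn hXn => (hPF _ _ _ _ _).2 (hstep L M K ((hPF _ _ _ _ _).1 hK) n hn hXn)⟩

end Shape

/-! ## §2 Instance: gen 5 (`klPredsV14`, closed by `KLRegimeCounterterm.KLRegimeCountertermV14_of`) re-derived in one call -/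

/-- Gen 5: `CountertermP2 klPredsV14 klWindowC` (the child of record, p488933/p491917) is `countertermP2_of_shapeJD_frameOK` at `H := histV14`
with identity maps, the V14 accessors and `twoLegVolumeRate_apply_of_V14`. -/
example : CountertermP2 klPredsV14 klWindowC :=
  countertermP2_of_shapeJD_frameOK (Pr := klPredsV14) (fun L M _ _ G P Q R β U μ K j => histV14 L M G P Q R β U μ K j)
    (fun _ _ _ _ _ => Iff.rfl) (fun _ _ _ _ _ _ _ _ _ _ h => h) (fun _ _ _ _ _ _ _ _ _ _ _ _ _ hs hr he => ⟨hs, hr, he⟩)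
    (fun _ _ _ _ _ _ _ _ _ _ _ _ h => ⟨(twoLegCoreT_of_twoLegStepV14 h).1, (twoLegCoreT_of_twoLegStepV14 h).2.1,
      twoLegSizesMST_of_twoLegStepV14 h⟩)
    (fun _ _ _ _ _ _ _ _ _ _ _ _ _ _ h hM _ hall L' M' _ _ hL hM' hMq θ =>
      twoLegVolumeRate_apply_of_V14 h hM hL hM' (hall L' M' hL hM' hMq) θ)

end CtJ

end Summit.HubbardSuperconductivity.HubbardSuperconductivity.Theorems.KLRegimeSplit

end
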